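import Literature.MathematicalPhysics.QuantumLattice.FockMapOpD4
import Literature.MathematicalPhysics.QuantumLattice.HubbardTorusFluxStiffnessResponse
import HarnessLib

/-!
# A point-group selection rule for the persistent current of the Hubbard torus

Topic `Literature/MathematicalPhysics/QuantumLattice` (family `hubbard`); companion of
`HubbardTorusFluxStiffnessResponse.lean` (necessary conditions of a flux stiffness) and
`FockMapOpD4.lean` (the second-quantised point group `D₄` of the square torus,
`Γ(γ) = fockMapOp (d4Orb γ)`). Everything here is PROVED; no definitions, no named facts.

Setting. `HubbardTorusFluxStiffnessResponse.sum_im_hop_eq_zero_of_isGroundStateInSector` shows that a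
flux stiffness (even a local minimum of the flux envelope `E_L(θ)` at `θ = 0`) forces EVERY zero-flux
`(N_L, 0)`-sector ground state `ψ` of `hubbardTorus 2 L 1 U` to carry zero total `e₁`-current
`J(ψ) = Σ_{x,σ} Im⟨ψ, c†_{x+e₁,σ} c_{x,σ} ψ⟩` — a condition on the whole (possibly degenerate) sector
ground space. This file records when that condition is met for symmetry reasons alone:

* `im_star_dotProduct_mulVec_eq_zero_of_intertwine` — abstract selection rule: if `Γ` is an
  isometry (`Γᴴ Γ v = v`) with `Γ T = Tᴴ Γ`, then `⟨ψ, T ψ⟩` is real on every eigenvector `ψ` of `Γ`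
  (for the eigenvalue `ε`: `⟨ψ,Tψ⟩ = |ε|² conj⟨ψ,Tψ⟩`).
* `d4Site_r_two`, `d4Orb_r_two_orb` — the `π`-rotation `r² ∈ D₄` acts on torus sites as `x ↦ -x`.
* `fockMapOp_r_two_mul_hopSum` — the `π`-rotation REVERSES the `e₁`-hopping operator:
  `Γ(r²) T₁ = T₁ᴴ Γ(r²)` for `T₁ = Σ_{x,σ} c†_{x+e₁,σ} c_{x,σ}` (so `K₁ = Re T₁` is `C₂`-even and the
  current `J₁ = Im T₁` is `C₂`-odd).
* `sum_im_hop_eq_zero_of_rotation_eigenvector` — consequently `J(ψ) = 0` for every eigenvector `ψ` of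
  `Γ(r²)`; in particular (`sum_im_hop_eq_zero_of_isGroundStateInSector_of_isotypic`) if the `π`-rotation
  acts as a scalar on the `(N, S^z = M)`-sector ground space of the Hubbard torus ("`C₂`-isotypic"
  ground space, e.g. a unique ground state, or the chiral `d ± id` doublet whose finite-volume members
  are the `B₁g`/`B₂g` combinations, both `C₂`-even), every sector ground state has zero `e₁`-current:
  the necessary condition of a flux stiffness is then automatic, and a violation of it requires a
  sector ground space mixing the two `C₂`-parities (momentum doublets / current-carrying ground states).

This is the standard symmetry argument behind Bloch's theorem on persistent currents (Bohm 1949;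
Watanabe 2019 §2, §4.1: the ground-state current vanishes whenever the ground state may be chosen
invariant under a symmetry reversing the current), written for the tree's `fockMapOp`/`d4Orb` and the
current functional of `HubbardTorusFluxStiffnessResponse`.

## References

* D. Bohm, Phys. Rev. 75 (1949) 502. [Bohm1949]
* H. Watanabe, J. Stat. Phys. 177 (2019) 717, §2.2.1, §4.1. [Watanabe2019]
* D. J. Scalapino, Phys. Rep. 250 (1995) 329, §2 (point group `C₄ᵥ ≅ D₄` of the square lattice,
  characters of `B₁g`, `B₂g`: `C₂`-even). [Scalapino1995]
* F. H. L. Essler et al., *The One-Dimensional Hubbard Model*, CUP 2005, §2.2.2 (spatial symmetries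
  as unitary second-quantised site permutations). [EsslerEtAl2005]
-/

noncomputable section

namespace Literature.MathematicalPhysics.QuantumLattice

open Matrix Finset Literature.MathematicalPhysics.QuantumFieldTheory
  Literature.Probability.LatticeModels HubbardWave0

/-! ### Abstract selection rule -/

section Abstract

variable {n : Type*} [Fintype n]

/-- **Selection rule.** Let `Γ` be an isometry (`Γᴴ Γ v = v` for all `v`) intertwining `T` with its
adjoint, `Γ T = Tᴴ Γ`. Then on every eigenvector `ψ` of `Γ` (`Γ ψ = ε ψ`) the expectation `⟨ψ, T ψ⟩` is
real: `⟨ψ,Tψ⟩ = ⟨Γψ, ΓTψ⟩ = ⟨Γψ, Tᴴ Γψ⟩ = |ε|² ⟨ψ, Tᴴψ⟩ = |ε|² conj⟨ψ,Tψ⟩`, whence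
`(1 + |ε|²) Im⟨ψ,Tψ⟩ = 0` (Watanabe 2019 §2: a current reversed by a symmetry of the state vanishes).
[folklore] -/
theorem im_star_dotProduct_mulVec_eq_zero_of_intertwine {Γ T : Matrix n n ℂ}
    (hΓ : ∀ v : n → ℂ, Γᴴ *ᵥ (Γ *ᵥ v) = v) (hT : Γ * T = Tᴴ * Γ) {ψ : n → ℂ} {ε : ℂ}
    (hψ : Γ *ᵥ ψ = ε • ψ) : (star ψ ⬝ᵥ (T *ᵥ ψ)).im = 0 := by
  have hconj : star ψ ⬝ᵥ (Tᴴ *ᵥ ψ) = star (star ψ ⬝ᵥ (T *ᵥ ψ)) := by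
    rw [Matrix.dotProduct_mulVec, ← Matrix.star_mulVec, Matrix.star_dotProduct]
  have hpush : Γ *ᵥ (T *ᵥ ψ) = Tᴴ *ᵥ (Γ *ᵥ ψ) := by
    rw [Matrix.mulVec_mulVec, Matrix.mulVec_mulVec, hT]
  have key : star ψ ⬝ᵥ (T *ᵥ ψ) = (star ε * ε) * star (star ψ ⬝ᵥ (T *ᵥ ψ)) := by
    calc star ψ ⬝ᵥ (T *ᵥ ψ)
        = star ψ ⬝ᵥ (Γᴴ *ᵥ (Γ *ᵥ (T *ᵥ ψ))) := by rw [hΓ]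
      _ = star ψ ⬝ᵥ (Γᴴ *ᵥ (Tᴴ *ᵥ (Γ *ᵥ ψ))) := by rw [hpush]
      _ = star (Γ *ᵥ ψ) ⬝ᵥ (Tᴴ *ᵥ (Γ *ᵥ ψ)) := by
          rw [Matrix.dotProduct_mulVec (star ψ) Γᴴ, ← Matrix.star_mulVec]
      _ = star (ε • ψ) ⬝ᵥ (Tᴴ *ᵥ (ε • ψ)) := by rw [hψ]
      _ = (star ε * ε) * (star ψ ⬝ᵥ (Tᴴ *ᵥ ψ)) := by
          rw [star_smul, Matrix.mulVec_smul, smul_dotProduct, dotProduct_smul, smul_smul,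
            smul_eq_mul]
      _ = (star ε * ε) * star (star ψ ⬝ᵥ (T *ᵥ ψ)) := by rw [hconj]
  have hre : (star ε * ε : ℂ) = ((Complex.normSq ε : ℝ) : ℂ) := by
    rw [Complex.normSq_eq_conj_mul_self, Complex.star_def]
  rw [hre] at key
  have him : (star ψ ⬝ᵥ (T *ᵥ ψ)).im = Complex.normSq ε * (-(star ψ ⬝ᵥ (T *ᵥ ψ)).im) := by
    have h := congr_arg Complex.im key
    rwa [Complex.mul_im, Complex.ofReal_re, Complex.ofReal_im, zero_mul, add_zero,
      Complex.star_def, Complex.conj_im] at h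
  have hpos : 0 ≤ Complex.normSq ε := Complex.normSq_nonneg ε
  nlinarith [mul_nonneg hpos (mul_self_nonneg (star ψ ⬝ᵥ (T *ᵥ ψ)).im)]

end Abstract

/-! ### The `π`-rotation of the square torus reverses the `e₁`-hopping operator -/

section Torus

variable {L : ℕ} [NeZero L]

omit [NeZero L] in
/-- The `π`-rotation `r² : (a, b) ↦ (-a, -b)` of `D₄` acts on torus sites as negation.
[cite: Scalapino1995, §2] -/
theorem d4Site_r_two (x : TorusSite 2 L) : d4Site (DihedralGroup.r 2 : DihedralGroup 4) x = -x := by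
  show rotSite^[(2 : ZMod 4).val] x = -x
  have h2 : (2 : ZMod 4).val = 2 := rfl
  rw [h2, Function.iterate_succ, Function.iterate_one, Function.comp_apply]
  funext i
  fin_cases i <;> simp [rotSite]

/-- On orbitals: the `π`-rotation sends `(y, σ)` to `(-y, σ)`. [cite: Scalapino1995, §2] -/
theorem d4Orb_r_two_orb (y : TorusSite 2 L) (σ : Fin 2) :
    d4Orb (DihedralGroup.r 2 : DihedralGroup 4) (orb (FermionTorus.ofTorusSite y) σ) =
      orb (FermionTorus.ofTorusSite (-y)) σ := by
  simp only [d4Orb, orb, ofLex_toLex, FermionTorus.toTorusSite_ofTorusSite, d4Site_r_two]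

/-- **The `π`-rotation reverses the `e₁`-hopping operator**: with `Γ = fockMapOp (d4Orb r²)` and
`T₁ = Σ_{x,σ} c†_{x+e₁,σ} c_{x,σ}`, `Γ T₁ = T₁ᴴ Γ` (`Γ c†_{x+e₁} c_x Γᴴ = c†_{-x-e₁} c_{-x}`, and
`x ↦ -x - e₁` re-indexes the sum into `Σ c†_{x} c_{x+e₁} = T₁ᴴ`). Hence the `e₁`-kinetic weight is
`C₂`-even and the `e₁`-current `C₂`-odd. [folklore] -/
theorem fockMapOp_r_two_mul_hopSum :
    fockMapOp (d4Orb (DihedralGroup.r 2 : DihedralGroup 4) :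
        Orb (FermionTorus 2 L) → Orb (FermionTorus 2 L)) *
        (∑ x : Site 2 L, ∑ σ : Fin 2,
          creation (orb (FermionTorus.ofTorusSite (Site.shift x 0)) σ) *
            annihilation (orb (FermionTorus.ofTorusSite x) σ)) =
      (∑ x : Site 2 L, ∑ σ : Fin 2,
          creation (orb (FermionTorus.ofTorusSite (Site.shift x 0)) σ) *
            annihilation (orb (FermionTorus.ofTorusSite x) σ))ᴴ *
        fockMapOp (d4Orb (DihedralGroup.r 2 : DihedralGroup 4) :
          Orb (FermionTorus 2 L) → Orb (FermionTorus 2 L)) := by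
  set Γ := fockMapOp (d4Orb (DihedralGroup.r 2 : DihedralGroup 4) :
    Orb (FermionTorus 2 L) → Orb (FermionTorus 2 L)) with hΓ
  have hbij := d4Orb_bijective (L := L) (DihedralGroup.r 2 : DihedralGroup 4)
  -- push `Γ` through each hopping term
  have hterm : ∀ (x : Site 2 L) (σ : Fin 2),
      Γ * (creation (orb (FermionTorus.ofTorusSite (Site.shift x 0)) σ) *
            annihilation (orb (FermionTorus.ofTorusSite x) σ)) =
        creation (orb (FermionTorus.ofTorusSite (-(Site.shift x 0))) σ) *
          annihilation (orb (FermionTorus.ofTorusSite (-x)) σ) * Γ := by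
    intro x σ
    rw [← Matrix.mul_assoc, hΓ, fockMapOp_mul_creation, Matrix.mul_assoc,
      fockMapOp_mul_annihilation _ hbij, ← Matrix.mul_assoc, d4Orb_r_two_orb, d4Orb_r_two_orb]
  -- the adjoint of the hopping sum
  have hct : (∑ x : Site 2 L, ∑ σ : Fin 2,
          creation (orb (FermionTorus.ofTorusSite (Site.shift x 0)) σ) *
            annihilation (orb (FermionTorus.ofTorusSite x) σ))ᴴ =
      ∑ x : Site 2 L, ∑ σ : Fin 2,
          creation (orb (FermionTorus.ofTorusSite x) σ) *
            annihilation (orb (FermionTorus.ofTorusSite (Site.shift x 0)) σ) := by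
    simp only [Matrix.conjTranspose_sum, Matrix.conjTranspose_mul, creation_conjTranspose,
      annihilation_conjTranspose]
  rw [hct, Finset.mul_sum, Finset.sum_mul]
  simp_rw [Finset.mul_sum, Finset.sum_mul, hterm]
  -- re-index the left-hand side by the involution `x ↦ -e₁ - x`
  refine Fintype.sum_equiv (Equiv.subLeft (-(Pi.single 0 1 : Site 2 L))) _ _ fun x => ?_
  have h1 : -(Site.shift x 0) = Equiv.subLeft (-(Pi.single 0 1 : Site 2 L)) x := by
    rw [Equiv.subLeft_apply, Literature.MathematicalPhysics.QuantumFieldTheory.Site.shift]; abel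
  have h2 : -x = Site.shift (Equiv.subLeft (-(Pi.single 0 1 : Site 2 L)) x) 0 := by
    rw [Equiv.subLeft_apply, Literature.MathematicalPhysics.QuantumFieldTheory.Site.shift]; abel
  rw [h1, h2]

/-- **Eigenvectors of the `π`-rotation carry no `e₁`-current.** If `Γ(r²) ψ = ε ψ` then
`J(ψ) = Σ_{x,σ} Im⟨ψ, c†_{x+e₁,σ} c_{x,σ} ψ⟩ = 0` (the current functional of
`HubbardTorusFluxStiffnessResponse`). Bloch/Bohm symmetry argument (Bohm 1949; Watanabe 2019 §4.1).
[folklore] -/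
theorem sum_im_hop_eq_zero_of_rotation_eigenvector {ψ : Fock (Orb (FermionTorus 2 L))} {ε : ℂ}
    (hψ : fockMapOp (d4Orb (DihedralGroup.r 2 : DihedralGroup 4) :
        Orb (FermionTorus 2 L) → Orb (FermionTorus 2 L)) *ᵥ ψ = ε • ψ) :
    ∑ x : Site 2 L, ∑ σ : Fin 2,
        (star ψ ⬝ᵥ ((creation (orb (FermionTorus.ofTorusSite (Site.shift x 0)) σ) *
          annihilation (orb (FermionTorus.ofTorusSite x) σ)) *ᵥ ψ)).im = 0 := by
  have hsum : (∑ x : Site 2 L, ∑ σ : Fin 2,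
        (star ψ ⬝ᵥ ((creation (orb (FermionTorus.ofTorusSite (Site.shift x 0)) σ) *
          annihilation (orb (FermionTorus.ofTorusSite x) σ)) *ᵥ ψ)).im) =
      (star ψ ⬝ᵥ ((∑ x : Site 2 L, ∑ σ : Fin 2,
          creation (orb (FermionTorus.ofTorusSite (Site.shift x 0)) σ) *
            annihilation (orb (FermionTorus.ofTorusSite x) σ)) *ᵥ ψ)).im := by
    simp only [Matrix.sum_mulVec, dotProduct_sum, Complex.im_sum]
  rw [hsum]
  refine im_star_dotProduct_mulVec_eq_zero_of_intertwine (fun v => ?_)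
    fockMapOp_r_two_mul_hopSum hψ
  rw [Matrix.mulVec_mulVec,
    conjTranspose_fockMapOp_mul_self _ (d4Orb_bijective (L := L) _).injective]
  -- `1` here carries the `DecidableEq` instance of the linear order; `convert` bridges instances
  convert Matrix.one_mulVec v <;> rfl

/-- **`C₂`-isotypic sector ground spaces carry no current.** If the `π`-rotation `Γ(r²)` acts as a
scalar `ε` on the `(N, S^z = M)`-sector ground space of the Hubbard torus `hubbardTorus 2 L t U`
(e.g. a unique sector ground state, which is an eigenvector of the commuting unitary `Γ(r²)`; or a
ground doublet whose members lie in one-dimensional representations of `D₄`, all `C₂`-even —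
Scalapino 1995 §2), then EVERY sector ground state has zero total `e₁`-current. Thus the necessary
condition `sum_im_hop_eq_zero_of_isGroundStateInSector` of a flux stiffness holds automatically there,
and can only fail on a sector ground space mixing the two `C₂`-parities. [folklore] -/
theorem sum_im_hop_eq_zero_of_isGroundStateInSector_of_isotypic {t U : ℝ} {N : ℕ} {M : ℝ} (ε : ℂ)
    (hiso : ∀ φ : Fock (Orb (FermionTorus 2 L)), IsGroundStateInSector (hubbardTorus 2 L t U) N M φ →
      fockMapOp (d4Orb (DihedralGroup.r 2 : DihedralGroup 4) :
        Orb (FermionTorus 2 L) → Orb (FermionTorus 2 L)) *ᵥ φ = ε • φ)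
    {ψ : Fock (Orb (FermionTorus 2 L))} (hψ : IsGroundStateInSector (hubbardTorus 2 L t U) N M ψ) :
    ∑ x : Site 2 L, ∑ σ : Fin 2,
        (star ψ ⬝ᵥ ((creation (orb (FermionTorus.ofTorusSite (Site.shift x 0)) σ) *
          annihilation (orb (FermionTorus.ofTorusSite x) σ)) *ᵥ ψ)).im = 0 :=
  sum_im_hop_eq_zero_of_rotation_eigenvector (hiso ψ hψ)

/-- **A unique sector ground state carries no current** (Bloch's theorem in Bohm's symmetry form):
if the `(N, S^z = M)`-sector ground space of `hubbardTorus 2 L t U` is one-dimensional — every sector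
ground state is a multiple of `ψ` — then `ψ` is an eigenvector of the commuting symmetry `Γ(r²)`
(`IsGroundStateInSector.fockMapOp_d4Orb_mulVec`), hence has zero total `e₁`-current. So a violation of
the zero-current condition forced by a flux stiffness needs a DEGENERATE sector ground space (and, by
`sum_im_hop_eq_zero_of_isGroundStateInSector_of_isotypic`, one mixing the two `C₂`-parities).
Bohm 1949; Watanabe 2019 §4.1. [folklore] -/
theorem sum_im_hop_eq_zero_of_isGroundStateInSector_of_unique {t U : ℝ} {N : ℕ} {M : ℝ}
    {ψ : Fock (Orb (FermionTorus 2 L))} (hψ : IsGroundStateInSector (hubbardTorus 2 L t U) N M ψ)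
    (huniq : ∀ φ : Fock (Orb (FermionTorus 2 L)), IsGroundStateInSector (hubbardTorus 2 L t U) N M φ →
      ∃ c : ℂ, φ = c • ψ) :
    ∑ x : Site 2 L, ∑ σ : Fin 2,
        (star ψ ⬝ᵥ ((creation (orb (FermionTorus.ofTorusSite (Site.shift x 0)) σ) *
          annihilation (orb (FermionTorus.ofTorusSite x) σ)) *ᵥ ψ)).im = 0 := by
  obtain ⟨c, hc⟩ := huniq _ (hψ.fockMapOp_d4Orb_mulVec (DihedralGroup.r 2 : DihedralGroup 4))
  exact sum_im_hop_eq_zero_of_rotation_eigenvector hc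

end Torus

end Literature.MathematicalPhysics.QuantumLattice

end
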